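import Summits.SmoothPoincare4.SmoothPoincare4.Theses.EntropyRung
import Summits.SmoothPoincare4.SmoothPoincare4.Theorems.EntropyRungSubcylindricalExistenceLargeScale
import Summits.SmoothPoincare4.SmoothPoincare4.Theorems.EntropyRungSubcylindricalExistenceGluingEnergyBound
import Literature.Geometry.Lorentzian.ChartLaplacian
import Literature.Geometry.Riemannian.BakryEmeryHeatFlow
import Literature.Geometry.Riemannian.PerelmanEntropyCutoff
import HarnessLib

/-!
# Large scales of the round-capped blow-up (line `green-blowup-conformal-entropy`,
# crux `EntropyRung.SubcylindricalExistence`, stmt-SmoothPoincare4-10871; helper for Stub D)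

The large-scale step of the lead's assembly `stub_conformalGluing` (reshape R-c2). For a smooth
conformal weight `ψ > 0` with `L_g ψ = R_g ψ − 6Δ_g ψ > 0`, `Vol := ∫ ψ⁴ dV_g` (the volume of
`ψ² g`) and a Yamabe–Sobolev inequality `Y √(∫ u⁴ψ⁴) ≤ ∫ (6ψ²|∇u|² + ψ L_gψ u²)` (all smooth `u`):
* `quadratic_ge`: every normalised test function (`∫ c w² ψ⁴ = 1`, `c = (4πτ)⁻²`) has quadratic part
  `∫ (r w² + 4ψ⁻²|∇w|²) c ψ⁴ ≥ (2/3) Y / √Vol`, `r = ψ⁻³L_gψ` (Cauchy–Schwarz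
  `∫ w²ψ⁴ ≤ √(∫w⁴ψ⁴) √Vol` and the Sobolev bound);
* `clause_of_largeScale`: consequently (H11 `largeScale_propagation`, p108874) a clause at level `L`
  valid at the single scale `τ₀ = 3√Vol / Y` propagates to every `τ ≥ τ₀`.
Everything is proved; no definitions, no named facts.
-/

noncomputable section

set_option linter.dupNamespace false

open scoped Manifold ContDiff Topology ENNReal
open Set Filter MeasureTheory
open Literature.Geometry.Lorentzian

namespace Summit.SmoothPoincare4.SmoothPoincare4.Theorems

namespace GluingLargeScales

variable {M : Type} [TopologicalSpace M] [T2Space M] [SecondCountableTopology M]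
  [ChartedSpace (EuclideanSpace ℝ (Fin 4)) M] [IsManifold (𝓡 4) ∞ M] [CompactSpace M]
  [T3Space M] [MeasurableSpace M] [BorelSpace M]
  (g : PseudoRiemannianMetric (𝓡 4) ∞ (EuclideanSpace ℝ (Fin 4)) (TangentSpace (𝓡 4) : M → Type _))

omit [T2Space M] [SecondCountableTopology M] in
/-- **Quadratic lower bound at every scale.** With `r = ψ⁻³L_gψ ≥ 0`, `Vol = ∫ ψ⁴ dV > 0` and the
Yamabe–Sobolev bound with constant `Y`, every normalised smooth `w` has
`(2/3) Y/√Vol ≤ ∫ (r w² + 4 ψ⁻²|∇w|²) c ψ⁴ dV`. [cite: LeeParker1987, §3] -/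
theorem quadratic_ge [g.HasLeviCivita] (hg : g.IsRiemannian) {Y : ℝ} (hY : 0 < Y) {ψ : M → ℝ}
    (hψ : ContMDiff (𝓡 4) 𝓘(ℝ, ℝ) ∞ ψ) (hψpos : ∀ x, 0 < ψ x)
    (hLψ : ∀ x, 0 < g.scalarCurvature x * ψ x - 6 * g.dalembertian ψ x)
    (hYS : ∀ u : M → ℝ, ContMDiff (𝓡 4) 𝓘(ℝ, ℝ) ∞ u →
      Y * Real.sqrt (∫ x, u x ^ 4 * ψ x ^ 4 ∂(riemannianMeasure (g.toContMDiffRiemannianMetric hg))) ≤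
        ∫ x, (6 * (ψ x ^ 2 * g.gradSq u x)
            + ψ x * (g.scalarCurvature x * ψ x - 6 * g.dalembertian ψ x) * u x ^ 2)
          ∂(riemannianMeasure (g.toContMDiffRiemannianMetric hg)))
    (hVol : 0 < ∫ x, ψ x ^ 4 ∂(riemannianMeasure (g.toContMDiffRiemannianMetric hg))) :
    ∀ τ : ℝ, 0 < τ → ∀ w : M → ℝ, ContMDiff (𝓡 4) 𝓘(ℝ, ℝ) ∞ w →
      ∫ x, (4 * Real.pi * τ) ^ (-(4 : ℝ) / 2) * (w x) ^ 2 * (ψ x) ^ 4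
          ∂(riemannianMeasure (g.toContMDiffRiemannianMetric hg)) = 1 →
        2 / 3 * Y / Real.sqrt (∫ x, ψ x ^ 4 ∂(riemannianMeasure (g.toContMDiffRiemannianMetric hg))) ≤
          ∫ x, ((fun y ↦ (ψ y ^ 3)⁻¹ * (g.scalarCurvature y * ψ y - 6 * g.dalembertian ψ y)) x * (w x) ^ 2
              + 4 * ((ψ x)⁻¹ ^ 2 * g.gradSq w x))
              * ((4 * Real.pi * τ) ^ (-(4 : ℝ) / 2) * (ψ x) ^ 4)
            ∂(riemannianMeasure (g.toContMDiffRiemannianMetric hg)) := by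
  intro τ hτ w hw hnorm
  set μ : Measure M := riemannianMeasure (g.toContMDiffRiemannianMetric hg) with hμ
  set c : ℝ := (4 * Real.pi * τ) ^ (-(4 : ℝ) / 2) with hc
  have hcpos : 0 < c := Real.rpow_pos_of_pos (by positivity) _
  set V : ℝ := ∫ x, ψ x ^ 4 ∂μ with hV
  have hsV : 0 < Real.sqrt V := Real.sqrt_pos.2 hVol
  have hψc : Continuous ψ := hψ.continuous
  have hwc : Continuous w := hw.continuous
  -- Cauchy–Schwarz: `1/c = ∫ w²ψ⁴ = ∫ c⁻¹… `; use `cutoffCost_le` with `Q = ψ²`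
  have hCS := GluingEnergyBound.cutoffCost_le g hg hcpos.le hwc hψc (hψc.pow 2) (fun x ↦ by positivity)
    (w := w) (ψ := ψ) (Q := fun x ↦ ψ x ^ 2)
  have hlhs : ∫ x, c * (w x) ^ 2 * (ψ x) ^ 2 * (ψ x ^ 2) ∂μ = 1 := by
    rw [← hnorm]
    refine integral_congr_ae (ae_of_all _ fun x ↦ ?_)
    ring
  have hQ2 : ∫ x, (ψ x ^ 2) ^ 2 ∂μ = V := by
    rw [hV]
    refine integral_congr_ae (ae_of_all _ fun x ↦ ?_)
    ring
  rw [hlhs, hQ2] at hCS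
  -- `hCS : 1 ≤ c √(∫ w⁴ψ⁴) √V`
  set I4 : ℝ := ∫ x, (w x) ^ 4 * (ψ x) ^ 4 ∂μ with hI4
  have hYSw := hYS w hw
  have hI4' : ∫ x, w x ^ 4 * ψ x ^ 4 ∂μ = I4 := rfl
  rw [hI4'] at hYSw
  -- the quadratic part dominates `(2/3) c B`
  set r : M → ℝ := fun y ↦ (ψ y ^ 3)⁻¹ * (g.scalarCurvature y * ψ y - 6 * g.dalembertian ψ y) with hr
  have hrψ : ∀ x, ψ x * (g.scalarCurvature x * ψ x - 6 * g.dalembertian ψ x) = (ψ x) ^ 4 * r x := by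
    intro x
    have hψx : ψ x ≠ 0 := (hψpos x).ne'
    simp only [hr]
    field_simp
  have hr0 : ∀ x, 0 ≤ r x := fun x ↦ (mul_pos (inv_pos.2 (pow_pos (hψpos x) 3)) (hLψ x)).le
  have hψ2 : ContMDiff (𝓡 4) 𝓘(ℝ, ℝ) 2 ψ := hψ.of_le (WithTop.coe_le_coe.mpr le_top)
  have hrc : Continuous r := by
    have hΔ : Continuous (g.dalembertian ψ) := continuous_dalembertian g hψ2
    have hR : Continuous g.scalarCurvature := g.contMDiff_scalarCurvature.continuous
    exact ((hψc.pow 3).inv₀ fun x ↦ (pow_pos (hψpos x) 3).ne').mul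
      ((hR.mul hψc).sub (continuous_const.mul hΔ))
  have hGw : Continuous (g.gradSq w) := (Literature.Geometry.Riemannian.contMDiff_gradSq g hw).continuous
  have hψinv : Continuous fun x ↦ (ψ x)⁻¹ := hψc.inv₀ fun x ↦ (hψpos x).ne'
  set B : ℝ := ∫ x, (6 * (ψ x ^ 2 * g.gradSq w x)
      + ψ x * (g.scalarCurvature x * ψ x - 6 * g.dalembertian ψ x) * w x ^ 2) ∂μ with hB
  have iB : Integrable (fun x ↦ 6 * (ψ x ^ 2 * g.gradSq w x)
      + ψ x * (g.scalarCurvature x * ψ x - 6 * g.dalembertian ψ x) * w x ^ 2) μ := by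
    have : (fun x ↦ 6 * (ψ x ^ 2 * g.gradSq w x)
        + ψ x * (g.scalarCurvature x * ψ x - 6 * g.dalembertian ψ x) * w x ^ 2) =
        fun x ↦ 6 * (ψ x ^ 2 * g.gradSq w x) + (ψ x) ^ 4 * r x * w x ^ 2 := by
      funext x; rw [hrψ x]
    rw [this]
    exact EntropyLocalisation.integrable_of_continuous g hg
      ((continuous_const.mul ((hψc.pow 2).mul hGw)).add (((hψc.pow 4).mul hrc).mul (hwc.pow 2)))
  have iQ : Integrable (fun x ↦ (r x * (w x) ^ 2 + 4 * ((ψ x)⁻¹ ^ 2 * g.gradSq w x)) * (c * (ψ x) ^ 4)) μ :=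
    EntropyLocalisation.integrable_of_continuous g hg
      (((hrc.mul (hwc.pow 2)).add (continuous_const.mul ((hψinv.pow 2).mul hGw))).mul
        (continuous_const.mul (hψc.pow 4)))
  have hA : 2 / 3 * (c * B) ≤
      ∫ x, (r x * (w x) ^ 2 + 4 * ((ψ x)⁻¹ ^ 2 * g.gradSq w x)) * (c * (ψ x) ^ 4) ∂μ := by
    rw [hB, ← integral_const_mul, ← integral_const_mul]
    refine integral_mono ((iB.const_mul c).const_mul _) iQ fun x ↦ ?_
    have hψx : ψ x ≠ 0 := (hψpos x).ne'
    rw [hrψ x]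
    have hkey : (r x * (w x) ^ 2 + 4 * ((ψ x)⁻¹ ^ 2 * g.gradSq w x)) * (c * (ψ x) ^ 4)
        - 2 / 3 * (c * (6 * (ψ x ^ 2 * g.gradSq w x) + (ψ x) ^ 4 * r x * w x ^ 2))
        = 1 / 3 * (c * ((ψ x) ^ 4 * (r x * (w x) ^ 2))) := by
      field_simp
      ring
    have hnn : 0 ≤ 1 / 3 * (c * ((ψ x) ^ 4 * (r x * (w x) ^ 2))) := by
      have := hr0 x; positivity
    linarith
  -- combine: `1 ≤ c √I4 √V`, `Y √I4 ≤ B` ⇒ `(2/3) Y/√V ≤ (2/3) c B`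
  have h1 : Y / Real.sqrt V ≤ c * B := by
    rw [div_le_iff₀ hsV]
    have hI40 : 0 ≤ Real.sqrt I4 := Real.sqrt_nonneg _
    have : Y ≤ c * B * Real.sqrt V := by
      calc Y = Y * 1 := (mul_one Y).symm
        _ ≤ Y * (c * Real.sqrt I4 * Real.sqrt V) := mul_le_mul_of_nonneg_left hCS hY.le
        _ = c * (Y * Real.sqrt I4) * Real.sqrt V := by ring
        _ ≤ c * B * Real.sqrt V := by
            refine mul_le_mul_of_nonneg_right ?_ hsV.le
            exact mul_le_mul_of_nonneg_left hYSw hcpos.le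
    linarith
  calc 2 / 3 * Y / Real.sqrt V = 2 / 3 * (Y / Real.sqrt V) := by ring
    _ ≤ 2 / 3 * (c * B) := mul_le_mul_of_nonneg_left h1 (by norm_num)
    _ ≤ _ := hA

omit [T2Space M] in
/-- **All large scales from one.** With the data of `quadratic_ge` and `τ₀ = 3√Vol/Y`, a
`ψ`-weighted clause at level `L` valid for all normalised smooth `w` at the scale `τ₀` holds at every
scale `τ ≥ τ₀` (H11 `largeScale_propagation` with `a = (2/3)Y/√Vol`, `a τ₀ = 2`).
[cite: Perelman2002Entropy, §3.1] -/
theorem clause_of_largeScale [g.HasLeviCivita] (hg : g.IsRiemannian) {Y : ℝ} (hY : 0 < Y) {ψ : M → ℝ}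
    (hψ : ContMDiff (𝓡 4) 𝓘(ℝ, ℝ) ∞ ψ) (hψpos : ∀ x, 0 < ψ x)
    (hLψ : ∀ x, 0 < g.scalarCurvature x * ψ x - 6 * g.dalembertian ψ x)
    (hYS : ∀ u : M → ℝ, ContMDiff (𝓡 4) 𝓘(ℝ, ℝ) ∞ u →
      Y * Real.sqrt (∫ x, u x ^ 4 * ψ x ^ 4 ∂(riemannianMeasure (g.toContMDiffRiemannianMetric hg))) ≤
        ∫ x, (6 * (ψ x ^ 2 * g.gradSq u x)
            + ψ x * (g.scalarCurvature x * ψ x - 6 * g.dalembertian ψ x) * u x ^ 2)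
          ∂(riemannianMeasure (g.toContMDiffRiemannianMetric hg)))
    (hVol : 0 < ∫ x, ψ x ^ 4 ∂(riemannianMeasure (g.toContMDiffRiemannianMetric hg))) {L : ℝ}
    (hbase : ∀ w : M → ℝ, ContMDiff (𝓡 4) 𝓘(ℝ, ℝ) ∞ w →
      ∫ x, (4 * Real.pi * (3 * Real.sqrt (∫ x, ψ x ^ 4 ∂(riemannianMeasure (g.toContMDiffRiemannianMetric hg))) / Y))
            ^ (-(4 : ℝ) / 2) * (w x) ^ 2 * (ψ x) ^ 4
          ∂(riemannianMeasure (g.toContMDiffRiemannianMetric hg)) = 1 →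
        L ≤ ∫ x, ((3 * Real.sqrt (∫ x, ψ x ^ 4 ∂(riemannianMeasure (g.toContMDiffRiemannianMetric hg))) / Y) *
              ((ψ x ^ 3)⁻¹ * (g.scalarCurvature x * ψ x - 6 * g.dalembertian ψ x) * (w x) ^ 2
                + 4 * ((ψ x)⁻¹ ^ 2 * g.gradSq w x))
            - (w x) ^ 2 * Real.log ((w x) ^ 2) - 4 * (w x) ^ 2)
            * ((4 * Real.pi * (3 * Real.sqrt (∫ x, ψ x ^ 4 ∂(riemannianMeasure (g.toContMDiffRiemannianMetric hg))) / Y))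
              ^ (-(4 : ℝ) / 2) * (ψ x) ^ 4)
          ∂(riemannianMeasure (g.toContMDiffRiemannianMetric hg))) :
    ∀ τ : ℝ, 3 * Real.sqrt (∫ x, ψ x ^ 4 ∂(riemannianMeasure (g.toContMDiffRiemannianMetric hg))) / Y ≤ τ →
      ∀ w : M → ℝ, ContMDiff (𝓡 4) 𝓘(ℝ, ℝ) ∞ w →
        ∫ x, (4 * Real.pi * τ) ^ (-(4 : ℝ) / 2) * (w x) ^ 2 * (ψ x) ^ 4
            ∂(riemannianMeasure (g.toContMDiffRiemannianMetric hg)) = 1 →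
          L ≤ ∫ x, (τ * ((ψ x ^ 3)⁻¹ * (g.scalarCurvature x * ψ x - 6 * g.dalembertian ψ x) * (w x) ^ 2
                + 4 * ((ψ x)⁻¹ ^ 2 * g.gradSq w x))
              - (w x) ^ 2 * Real.log ((w x) ^ 2) - 4 * (w x) ^ 2)
              * ((4 * Real.pi * τ) ^ (-(4 : ℝ) / 2) * (ψ x) ^ 4)
            ∂(riemannianMeasure (g.toContMDiffRiemannianMetric hg)) := by
  set μ : Measure M := riemannianMeasure (g.toContMDiffRiemannianMetric hg) with hμ
  set V : ℝ := ∫ x, ψ x ^ 4 ∂μ with hV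
  have hsV : 0 < Real.sqrt V := Real.sqrt_pos.2 hVol
  set τ₀ : ℝ := 3 * Real.sqrt V / Y with hτ₀
  set a : ℝ := 2 / 3 * Y / Real.sqrt V with ha
  have hτ₀pos : 0 < τ₀ := by positivity
  have hapos : 0 < a := by positivity
  have haτ : 2 ≤ a * τ₀ := by
    rw [ha, hτ₀]
    field_simp
    nlinarith [hsV, hY]
  set r : M → ℝ := fun y ↦ (ψ y ^ 3)⁻¹ * (g.scalarCurvature y * ψ y - 6 * g.dalembertian ψ y) with hr
  have hψc : Continuous ψ := hψ.continuous
  have hψ2 : ContMDiff (𝓡 4) 𝓘(ℝ, ℝ) 2 ψ := hψ.of_le (WithTop.coe_le_coe.mpr le_top)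
  have hrc : Continuous r := by
    have hΔ : Continuous (g.dalembertian ψ) := continuous_dalembertian g hψ2
    have hR : Continuous g.scalarCurvature := g.contMDiff_scalarCurvature.continuous
    exact ((hψc.pow 3).inv₀ fun x ↦ (pow_pos (hψpos x) 3).ne').mul
      ((hR.mul hψc).sub (continuous_const.mul hΔ))
  have hquad := quadratic_ge g hg hY hψ hψpos hLψ hYS hVol
  intro τ hτ w hw hnorm
  exact largeScale_propagation M g hg ψ r hψ hψpos hrc L a τ₀ hτ₀pos hapos haτ hbase hquad τ hτ w hw hnorm

end GluingLargeScales

/-- **All large scales of the round-capped blow-up** (registered sub-goal `gluingLargeScales` of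
Stub D of line `green-blowup-conformal-entropy`; ∀-form of `GluingLargeScales.clause_of_largeScale`):
the Yamabe–Sobolev bound gives the quadratic lower bound `(2/3)Y/√Vol` at every scale, so a clause at
the scale `τ₀ = 3√Vol/Y` propagates to all `τ ≥ τ₀` (H11). [cite: Perelman2002Entropy, §3.1] -/
theorem gluingLargeScales :
    ∀ (M : Type) [TopologicalSpace M] [T2Space M] [SecondCountableTopology M]
      [ChartedSpace (EuclideanSpace ℝ (Fin 4)) M] [IsManifold (𝓡 4) ∞ M] [CompactSpace M]
      [T3Space M] [MeasurableSpace M] [BorelSpace M]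
      (g : PseudoRiemannianMetric (𝓡 4) ∞ (EuclideanSpace ℝ (Fin 4)) (TangentSpace (𝓡 4) : M → Type _))
      [g.HasLeviCivita] (hg : g.IsRiemannian) (Y : ℝ), 0 < Y → ∀ (ψ : M → ℝ),
      ContMDiff (𝓡 4) 𝓘(ℝ, ℝ) ∞ ψ → (∀ x, 0 < ψ x) →
      (∀ x, 0 < g.scalarCurvature x * ψ x - 6 * g.dalembertian ψ x) →
      (∀ u : M → ℝ, ContMDiff (𝓡 4) 𝓘(ℝ, ℝ) ∞ u →
        Y * Real.sqrt (∫ x, u x ^ 4 * ψ x ^ 4 ∂(riemannianMeasure (g.toContMDiffRiemannianMetric hg))) ≤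
          ∫ x, (6 * (ψ x ^ 2 * g.gradSq u x)
              + ψ x * (g.scalarCurvature x * ψ x - 6 * g.dalembertian ψ x) * u x ^ 2)
            ∂(riemannianMeasure (g.toContMDiffRiemannianMetric hg))) →
      0 < ∫ x, ψ x ^ 4 ∂(riemannianMeasure (g.toContMDiffRiemannianMetric hg)) → ∀ (L : ℝ),
      (∀ w : M → ℝ, ContMDiff (𝓡 4) 𝓘(ℝ, ℝ) ∞ w →
        ∫ x, (4 * Real.pi * (3 * Real.sqrt (∫ x, ψ x ^ 4 ∂(riemannianMeasure (g.toContMDiffRiemannianMetric hg))) / Y))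
              ^ (-(4 : ℝ) / 2) * (w x) ^ 2 * (ψ x) ^ 4
            ∂(riemannianMeasure (g.toContMDiffRiemannianMetric hg)) = 1 →
          L ≤ ∫ x, ((3 * Real.sqrt (∫ x, ψ x ^ 4 ∂(riemannianMeasure (g.toContMDiffRiemannianMetric hg))) / Y) *
                ((ψ x ^ 3)⁻¹ * (g.scalarCurvature x * ψ x - 6 * g.dalembertian ψ x) * (w x) ^ 2
                  + 4 * ((ψ x)⁻¹ ^ 2 * g.gradSq w x))
              - (w x) ^ 2 * Real.log ((w x) ^ 2) - 4 * (w x) ^ 2)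
              * ((4 * Real.pi * (3 * Real.sqrt (∫ x, ψ x ^ 4 ∂(riemannianMeasure (g.toContMDiffRiemannianMetric hg))) / Y))
                ^ (-(4 : ℝ) / 2) * (ψ x) ^ 4)
            ∂(riemannianMeasure (g.toContMDiffRiemannianMetric hg))) →
      ∀ τ : ℝ, 3 * Real.sqrt (∫ x, ψ x ^ 4 ∂(riemannianMeasure (g.toContMDiffRiemannianMetric hg))) / Y ≤ τ →
        ∀ w : M → ℝ, ContMDiff (𝓡 4) 𝓘(ℝ, ℝ) ∞ w →
          ∫ x, (4 * Real.pi * τ) ^ (-(4 : ℝ) / 2) * (w x) ^ 2 * (ψ x) ^ 4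
              ∂(riemannianMeasure (g.toContMDiffRiemannianMetric hg)) = 1 →
            L ≤ ∫ x, (τ * ((ψ x ^ 3)⁻¹ * (g.scalarCurvature x * ψ x - 6 * g.dalembertian ψ x) * (w x) ^ 2
                  + 4 * ((ψ x)⁻¹ ^ 2 * g.gradSq w x))
                - (w x) ^ 2 * Real.log ((w x) ^ 2) - 4 * (w x) ^ 2)
                * ((4 * Real.pi * τ) ^ (-(4 : ℝ) / 2) * (ψ x) ^ 4)
              ∂(riemannianMeasure (g.toContMDiffRiemannianMetric hg)) := by
  intro M _ _ _ _ _ _ _ _ _ g _ hg Y hY ψ hψ hψpos hLψ hYS hVol L hbase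
  exact GluingLargeScales.clause_of_largeScale g hg hY hψ hψpos hLψ hYS hVol hbase

end Summit.SmoothPoincare4.SmoothPoincare4.Theorems

end
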